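import Summits.RiemannHypothesis.RiemannHypothesis.Theorems.MotivicDoorFunctionFieldHonestFE

/-!
# The function-field door (FF-DOOR, statement (ii)) — part 8: the SIGNED door theorem (no honesty hypothesis)
(pub-rhdoor, seat ff-2, gen 3; HONEST FRAMING: lottery ticket at the motivic door; RH probability
negligible; consolation prizes are real: a new semi-local Weil-positivity theorem, or a located gap in the
Connes–Consani programme, plus the ff-door theorem.  Nothing in this file is a statement about `ζ`.)

So far the door theorem (`ffDoor_abelianVariety`, `windows_posSemidef_iff_exists_pow_geometric`) was
stated for HONEST data: `h` monic of EVEN degree `2g` with the functional equation `q^g c_j = q^i c_i`.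
This file removes the hypothesis.  Call the SIGNED functional equation of a monic `h ∈ ℤ[X]` of degree
`d` the identities `c₀ · c_j = q^i · c_i` (`i + j = d`), i.e. `x^d h(q/x) = c₀ h(x)` with `c₀ = h(0)`
(typed inline, never as a named predicate).  It forces `c₀² = q^d`, so `c₀ = ±q^{d/2}`; the sign `+`
is the honest case, and odd `d` is allowed (then `q` is a square).

* `reflect_comp_eq_of_twistedFE`, `frobRoots_map_reciprocal_of_twistedFE`,
  `zero_not_mem_frobRoots_of_twistedFE` — the signed FE closes the complex root multiset under
  `α ↦ q/α` with multiplicities and excludes `0` (ff-1's dictionary, re-keyed from `q^g` to `c₀`). [PROVED]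
* `twistedFE_of_map_reciprocal_deg` — conversely a reciprocal-closed root multiset with `c₀ ≠ 0` gives the
  signed FE, in every degree.  `twistedFE_of_rh_deg` — RH-true monic data satisfy the signed FE. [PROVED]
* `rh_iff_twistedFE_and_windows` — **THE SIGNED WEIL CRITERION, for every monic `h ∈ ℤ[X]` and every
  `q > 0`:** `RH(q,h) ⟺ (signed FE) ∧ (every window form `T_M(q,h)` is positive semidefinite)`, and one
  window of size `≥ deg h` suffices (`rh_iff_twistedFE_and_window`).  No parity, no honesty, no
  `h(0) ≠ 0` hypothesis: all of them moved to the checkable right-hand side.  [PROVED, no named fact]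
* `signedDoor_abelianVariety` — **THE SIGNED DOOR THEOREM over a finite field `K`, `q = #K`:** for every
  monic `h ∈ ℤ[X]` of positive degree, `(signed FE ∧ all windows PSD) ⟺ ∃ E ≥ 1, ∃ C/K, P_C = h^E`;
  `twistedFE_of_geometric_pow` — geometric up to a power ⇒ signed FE.  [PROVED from hW, hHT]
* `twistedFE_of_fe` — honest ⇒ signed FE: the earlier door theorem is the case `c₀ = +q^g`. [PROVED]
* Instances: `twistedFE_X_sub_C` — the ODD-degree datum `(s², x - s)` (`s ≠ 0`) is signed-honest with
  `c₀ = -s` and RH-true, hence geometric up to a power over `#K = s²` (`exists_pow_geometric_X_sub_C`,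
  from hHT); `twistedFE_X_sq_sub_C` — `(q, x² - q)` is signed-honest with the sign `-`.  [PROVED]
-/

open Polynomial
open scoped ComplexOrder
open Summit.RiemannHypothesis.RiemannHypothesis.Theorems.PfPersistence.FfAngleTwin
open Literature.AlgebraicGeometry.Motives

namespace Summit.RiemannHypothesis.RiemannHypothesis.Theorems.MotivicDoor.FunctionField

set_option linter.dupNamespace false

universe u

/-! ## The signed functional equation closes the root multiset under `α ↦ q/α` -/

/-- The signed FE over `ℂ`: `p_j · c₀ = q^i · p_i` for `p = h ⊗ ℂ`. [PROVED] -/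
theorem twistedFE_complex {q : ℕ} {h : ℤ[X]} {d : ℕ}
    (htw : ∀ i j, i + j = d → h.coeff 0 * h.coeff j = (q : ℤ) ^ i * h.coeff i) {i j : ℕ} (hij : i + j = d) :
    ((h.coeff 0 : ℤ) : ℂ) * (h.map (Int.castRingHom ℂ)).coeff j =
      (q : ℂ) ^ i * (h.map (Int.castRingHom ℂ)).coeff i := by
  rw [Polynomial.coeff_map, Polynomial.coeff_map, eq_intCast, eq_intCast]
  exact_mod_cast htw i j hij

/-- Signed FE ⇒ `reflect d (p(qX)) = c₀ · p`, i.e. `x^d p(q/x) = c₀ p(x)`. [PROVED] -/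
theorem reflect_comp_eq_of_twistedFE {q : ℕ} {h : ℤ[X]} {d : ℕ} (hdeg : h.natDegree = d)
    (htw : ∀ i j, i + j = d → h.coeff 0 * h.coeff j = (q : ℤ) ^ i * h.coeff i) :
    reflect d ((h.map (Int.castRingHom ℂ)).comp (C (q : ℂ) * X))
      = C ((h.coeff 0 : ℤ) : ℂ) * h.map (Int.castRingHom ℂ) := by
  ext i
  rw [coeff_reflect, comp_C_mul_X_coeff, coeff_C_mul]
  by_cases hi : i ≤ d
  · rw [revAt_le hi, twistedFE_complex htw (i := d - i) (j := i) (by omega), mul_comm]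
  · have hlt : d < i := not_le.1 hi
    have hz : (h.map (Int.castRingHom ℂ)).coeff i = 0 := by
      rw [coeff_map, coeff_eq_zero_of_natDegree_lt (by omega), map_zero]
    rw [revAt_eq_self_of_lt hlt, hz, zero_mul, mul_zero]

/-- Signed FE with `c₀ ≠ 0` ⇒ `mult_b(p) ≤ mult_{q/b}(p)` for `b ≠ 0`. [PROVED] -/
theorem rootMultiplicity_le_reciprocal_of_twistedFE {q : ℕ} (hq : 0 < q) {h : ℤ[X]} {d : ℕ}
    (hdeg : h.natDegree = d) (htw : ∀ i j, i + j = d → h.coeff 0 * h.coeff j = (q : ℤ) ^ i * h.coeff i)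
    (hc0 : h.coeff 0 ≠ 0) {b : ℂ} (hb : b ≠ 0) :
    rootMultiplicity b (h.map (Int.castRingHom ℂ)) ≤
      rootMultiplicity ((q : ℂ) / b) (h.map (Int.castRingHom ℂ)) := by
  set p : ℂ[X] := h.map (Int.castRingHom ℂ) with hp
  by_cases hp0 : p = 0
  · simp [hp0]
  have hqC : (q : ℂ) ≠ 0 := by exact_mod_cast hq.ne'
  have hpdeg : p.natDegree ≤ d := by rw [hp, ← hdeg]; exact natDegree_map_le
  have hcdeg : (p.comp (C (q : ℂ) * X)).natDegree ≤ d := by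
    refine (natDegree_le_iff_coeff_eq_zero).2 fun i hi => ?_
    rw [comp_C_mul_X_coeff, coeff_eq_zero_of_natDegree_lt (lt_of_le_of_lt hpdeg (by exact_mod_cast hi)),
      zero_mul]
  have h1 := X_sub_C_div_pow_dvd_comp hqC (pow_rootMultiplicity_dvd p b)
  have h2 := X_sub_C_inv_pow_dvd_reflect hcdeg (div_ne_zero hb hqC) h1
  rw [inv_div, reflect_comp_eq_of_twistedFE hdeg htw, ← hp] at h2
  have hc0C : ((h.coeff 0 : ℤ) : ℂ) ≠ 0 := by exact_mod_cast hc0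
  have hunit : IsUnit (C ((h.coeff 0 : ℤ) : ℂ)) := isUnit_C.2 (IsUnit.mk0 _ hc0C)
  exact (le_rootMultiplicity_iff hp0).2 (hunit.dvd_mul_left.1 h2)

/-- **Signed FE ⇒ reciprocal-closed root multiset** (`c₀ ≠ 0`, `q > 0`). [PROVED] -/
theorem frobRoots_map_reciprocal_of_twistedFE {q : ℕ} (hq : 0 < q) {h : ℤ[X]} {d : ℕ}
    (hdeg : h.natDegree = d) (htw : ∀ i j, i + j = d → h.coeff 0 * h.coeff j = (q : ℤ) ^ i * h.coeff i)
    (hc0 : h.coeff 0 ≠ 0) :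
    (frobRoots h).map (fun α => (q : ℂ) / α) = frobRoots h := by
  classical
  have hqC : (q : ℂ) ≠ 0 := by exact_mod_cast hq.ne'
  have hle : ∀ {b : ℂ}, b ≠ 0 → rootMultiplicity b (h.map (Int.castRingHom ℂ)) ≤
      rootMultiplicity ((q : ℂ) / b) (h.map (Int.castRingHom ℂ)) :=
    fun hb => rootMultiplicity_le_reciprocal_of_twistedFE hq hdeg htw hc0 hb
  have heq : ∀ {b : ℂ}, b ≠ 0 → rootMultiplicity ((q : ℂ) / b) (h.map (Int.castRingHom ℂ)) =
      rootMultiplicity b (h.map (Int.castRingHom ℂ)) := fun {b} hb => by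
    refine le_antisymm ?_ (hle hb)
    have := hle (b := (q : ℂ) / b) (div_ne_zero hqC hb)
    rwa [div_div_cancel₀ hqC] at this
  set f : ℂ → ℂ := fun α => (q : ℂ) / α with hf
  have hinv : ∀ α, f (f α) = α := by
    intro α
    by_cases hα : α = 0
    · simp [hf, hα]
    · simp only [hf]; rw [div_div_cancel₀ hqC]
  have hinj : Function.Injective f := fun x y hxy => by simpa [hinv] using congrArg f hxy
  ext a
  calc Multiset.count a ((frobRoots h).map f)
        = Multiset.count (f (f a)) ((frobRoots h).map f) := by rw [hinv]
    _ = Multiset.count (f a) (frobRoots h) := Multiset.count_map_eq_count' f _ hinj (f a)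
    _ = Multiset.count a (frobRoots h) := by
        simp only [frobRoots, count_roots, hf]
        by_cases ha : a = 0
        · simp [ha]
        · exact heq ha

/-- Signed FE of a MONIC `h` (`q > 0`) ⇒ `c₀² = q^d`; in particular `c₀ ≠ 0`. [PROVED] -/
theorem coeff_zero_sq_eq_of_twistedFE {q : ℕ} {h : ℤ[X]} {d : ℕ} (hh : h.Monic) (hdeg : h.natDegree = d)
    (htw : ∀ i j, i + j = d → h.coeff 0 * h.coeff j = (q : ℤ) ^ i * h.coeff i) :
    h.coeff 0 ^ 2 = (q : ℤ) ^ d := by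
  have htop : h.coeff d = 1 := by rw [← hdeg]; exact hh.coeff_natDegree
  have := htw d 0 (by omega)
  rw [htop, mul_one] at this
  rw [sq, this]

/-- Signed FE of a monic `h`, `q > 0` ⇒ `c₀ ≠ 0`. [PROVED] -/
theorem coeff_zero_ne_zero_of_twistedFE {q : ℕ} (hq : 0 < q) {h : ℤ[X]} {d : ℕ} (hh : h.Monic)
    (hdeg : h.natDegree = d) (htw : ∀ i j, i + j = d → h.coeff 0 * h.coeff j = (q : ℤ) ^ i * h.coeff i) :
    h.coeff 0 ≠ 0 := by
  intro h0
  have := coeff_zero_sq_eq_of_twistedFE (q := q) hh hdeg htw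
  rw [h0, sq, zero_mul] at this
  exact pow_ne_zero d (by exact_mod_cast hq.ne' : (q : ℤ) ≠ 0) this.symm

/-- Signed FE of a monic `h`, `q > 0` ⇒ `0` is not a complex root. [PROVED] -/
theorem zero_not_mem_frobRoots_of_twistedFE {q : ℕ} (hq : 0 < q) {h : ℤ[X]} {d : ℕ} (hh : h.Monic)
    (hdeg : h.natDegree = d) (htw : ∀ i j, i + j = d → h.coeff 0 * h.coeff j = (q : ℤ) ^ i * h.coeff i) :
    (0 : ℂ) ∉ frobRoots h := by
  intro h0
  change (0 : ℂ) ∈ (h.map (Int.castRingHom ℂ)).roots at h0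
  rw [mem_roots ((hh.map _).ne_zero), IsRoot.def, ← coeff_zero_eq_eval_zero, coeff_map, eq_intCast,
    Int.cast_eq_zero] at h0
  exact coeff_zero_ne_zero_of_twistedFE hq hh hdeg htw h0

/-! ## Conversely: reciprocal closure ⇒ signed FE, in every degree -/

/-- **Reciprocal-closed root multiset with `c₀ ≠ 0` ⇒ signed FE**, for monic `h` of ANY degree `d`
(`q > 0`). [PROVED; ff-1's reflect-and-compare argument with `c₀` in place of `q^g`] -/
theorem twistedFE_of_map_reciprocal_deg {q : ℕ} (hq : 0 < q) {h : ℤ[X]} {d : ℕ} (hh : h.Monic)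
    (hdeg : h.natDegree = d) (hrec : (frobRoots h).map (fun α => (q : ℂ) / α) = frobRoots h)
    (hc0 : h.coeff 0 ≠ 0) :
    ∀ i j, i + j = d → h.coeff 0 * h.coeff j = (q : ℤ) ^ i * h.coeff i := by
  classical
  have hqC : (q : ℂ) ≠ 0 := by exact_mod_cast hq.ne'
  set p : ℂ[X] := h.map (Int.castRingHom ℂ) with hp
  have hpm : p.Monic := hh.map _
  have hpdeg : p.natDegree = d := by rw [hp, hh.natDegree_map, hdeg]
  have hpr : p.roots = frobRoots h := rfl
  have hroots : Multiset.card p.roots = p.natDegree := by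
    rw [hpr, hpdeg, card_frobRoots_eq_natDegree, hdeg]
  have hpc : ∀ k, p.coeff k = ((h.coeff k : ℤ) : ℂ) := fun k => by rw [hp, coeff_map, eq_intCast]
  have hc0C : ((h.coeff 0 : ℤ) : ℂ) ≠ 0 := by exact_mod_cast hc0
  set L : ℂ[X] := reflect d (p.comp (C (q : ℂ) * X)) with hL
  have hcdeg : (p.comp (C (q : ℂ) * X)).natDegree ≤ d := by
    refine natDegree_le_iff_coeff_eq_zero.2 fun i hi => ?_
    rw [comp_C_mul_X_coeff, coeff_eq_zero_of_natDegree_lt (by rw [hpdeg]; exact_mod_cast hi), zero_mul]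
  have hLcoeff : ∀ i ≤ d, L.coeff i = p.coeff (d - i) * (q : ℂ) ^ (d - i) := fun i hi => by
    rw [hL, coeff_reflect, revAt_le hi, comp_C_mul_X_coeff]
  have hLtop : L.coeff d = ((h.coeff 0 : ℤ) : ℂ) := by
    rw [hLcoeff _ le_rfl, Nat.sub_self, pow_zero, mul_one, hpc]
  have hL0 : L ≠ 0 := fun h0 => by
    have := hLtop
    rw [h0, coeff_zero] at this
    exact hc0C this.symm
  have hLdeg : L.natDegree ≤ d := natDegree_reflect_le.trans (max_le le_rfl hcdeg)
  have hR0 : ¬ p.IsRoot 0 := fun h0 => by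
    rw [IsRoot.def, ← coeff_zero_eq_eval_zero, hpc] at h0
    exact hc0C h0
  have hle : p.roots ≤ L.roots := by
    refine Multiset.le_iff_count.2 fun β => ?_
    rw [count_roots, count_roots]
    by_cases hβ : β = 0
    · subst hβ; rw [rootMultiplicity_eq_zero hR0]; exact Nat.zero_le _
    · have h1 := X_sub_C_div_pow_dvd_comp hqC (pow_rootMultiplicity_dvd p ((q : ℂ) / β))
      have h2 := X_sub_C_inv_pow_dvd_reflect hcdeg (div_ne_zero (div_ne_zero hqC hβ) hqC) h1
      have hβ' : (((q : ℂ) / β) / (q : ℂ))⁻¹ = β := by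
        rw [div_right_comm, div_self hqC, one_div, inv_inv]
      rw [hβ', ← hL] at h2
      have hc := count_frobRoots_reciprocal hq hrec β
      rw [← hpr, count_roots, count_roots] at hc
      calc rootMultiplicity β p = rootMultiplicity ((q : ℂ) / β) p := hc.symm
        _ ≤ rootMultiplicity β L := (le_rootMultiplicity_iff hL0).2 h2
  have hdvd : p ∣ L := by
    have := (Multiset.prod_X_sub_C_dvd_iff_le_roots hL0 p.roots).2 hle
    rwa [prod_multiset_X_sub_C_of_monic_of_roots_card_eq hpm hroots] at this
  obtain ⟨r, hr⟩ := hdvd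
  have hr0 : r ≠ 0 := by
    rintro rfl
    exact hL0 (by rw [hr, mul_zero])
  have hrdeg : r.natDegree = 0 := by
    have := hLdeg
    rw [hr, natDegree_mul hpm.ne_zero hr0, hpdeg] at this
    omega
  obtain ⟨c, hc⟩ : ∃ c, r = C c := ⟨_, eq_C_of_natDegree_eq_zero hrdeg⟩
  rw [hc] at hr
  have hcq : c = ((h.coeff 0 : ℤ) : ℂ) := by
    have := hLtop
    rwa [hr, coeff_mul_C, ← hpdeg, hpm.coeff_natDegree, one_mul] at this
  intro i j hij
  have key := hLcoeff j (by omega)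
  rw [hr, coeff_mul_C, hcq, show d - j = i by omega, hpc, hpc] at key
  have : ((h.coeff 0 * h.coeff j : ℤ) : ℂ) = (((q : ℤ) ^ i * h.coeff i : ℤ) : ℂ) := by
    push_cast
    linear_combination key
  exact_mod_cast this

/-- **RH-true monic data satisfy the signed FE**, in every degree (`q > 0`). [PROVED] -/
theorem twistedFE_of_rh_deg {q : ℕ} (hq : 0 < q) {h : ℤ[X]} (hh : h.Monic)
    (hRH : ∀ α ∈ frobRoots h, ‖α‖ = Real.sqrt q) :
    ∀ i j, i + j = h.natDegree → h.coeff 0 * h.coeff j = (q : ℤ) ^ i * h.coeff i := by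
  refine twistedFE_of_map_reciprocal_deg hq hh rfl (frobRoots_map_natCast_div_of_rh hRH) ?_
  intro hc0
  have hroot : (0 : ℂ) ∈ frobRoots h := by
    change (0 : ℂ) ∈ (h.map (Int.castRingHom ℂ)).roots
    rw [mem_roots ((hh.map _).ne_zero), IsRoot.def, ← coeff_zero_eq_eval_zero, coeff_map, hc0, map_zero]
  have := hRH 0 hroot
  rw [norm_zero] at this
  exact (Real.sqrt_pos.2 (by exact_mod_cast hq)).ne' this.symm

/-- Honest ⇒ signed-honest: the coefficient FE in dimension `g` (monic, degree `2g`, `q > 0`) implies the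
signed FE with `c₀ = +q^g`. [PROVED] -/
theorem twistedFE_of_fe {q : ℕ} (hq : 0 < q) {h : ℤ[X]} {g : ℕ} (hh : h.Monic) (hdeg : h.natDegree = 2 * g)
    (hFE : ∀ i j, i + j = 2 * g → (q : ℤ) ^ g * h.coeff j = (q : ℤ) ^ i * h.coeff i) :
    ∀ i j, i + j = h.natDegree → h.coeff 0 * h.coeff j = (q : ℤ) ^ i * h.coeff i := by
  intro i j hij
  rw [coeff_zero_eq_of_fe hq hh hdeg hFE]
  exact hFE i j (by omega)

/-! ## The signed Weil criterion: no honesty hypothesis -/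

/-- **THE SIGNED WEIL CRITERION.**  For every `q > 0` and every MONIC `h ∈ ℤ[X]`:
`RH(q,h) ⟺ (signed FE) ∧ (all window forms T_M(q,h) are positive semidefinite)`.  [PROVED, no named fact] -/
theorem rh_iff_twistedFE_and_windows {q : ℕ} (hq : 0 < q) {h : ℤ[X]} (hh : h.Monic) :
    (∀ α ∈ frobRoots h, ‖α‖ = Real.sqrt q) ↔
      ((∀ i j, i + j = h.natDegree → h.coeff 0 * h.coeff j = (q : ℤ) ^ i * h.coeff i) ∧
        ∀ M, (weilWindowForm (q : ℝ) h M).PosSemidef) := by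
  have hqR : (0 : ℝ) < (q : ℝ) := by exact_mod_cast hq
  refine ⟨fun hRH => ⟨twistedFE_of_rh_deg hq hh hRH, fun M => weilWindowForm_posSemidef hqR hRH M⟩,
    fun ⟨htw, hpsd⟩ => ?_⟩
  have hrec := frobRoots_map_reciprocal_of_twistedFE hq rfl htw (coeff_zero_ne_zero_of_twistedFE hq hh rfl htw)
  have hrecR : (frobRoots h).map (fun α => ((q : ℝ) : ℂ) / α) = frobRoots h := by
    simpa only [Complex.ofReal_natCast] using hrec
  exact (weilWindowForm_posSemidef_forall_iff hqR hrecR (zero_not_mem_frobRoots_of_twistedFE hq hh rfl htw)).1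
    hpsd

/-- **ONE WINDOW SUFFICES**: for monic `h` and any `M` with `deg h ≤ M + 1`,
`RH(q,h) ⟺ (signed FE) ∧ T_M(q,h) ⪰ 0`. [PROVED, no named fact] -/
theorem rh_iff_twistedFE_and_window {q : ℕ} (hq : 0 < q) {h : ℤ[X]} (hh : h.Monic) {M : ℕ}
    (hM : h.natDegree ≤ M + 1) :
    (∀ α ∈ frobRoots h, ‖α‖ = Real.sqrt q) ↔
      ((∀ i j, i + j = h.natDegree → h.coeff 0 * h.coeff j = (q : ℤ) ^ i * h.coeff i) ∧
        (weilWindowForm (q : ℝ) h M).PosSemidef) := by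
  have hqR : (0 : ℝ) < (q : ℝ) := by exact_mod_cast hq
  refine ⟨fun hRH => ⟨twistedFE_of_rh_deg hq hh hRH, weilWindowForm_posSemidef hqR hRH M⟩,
    fun ⟨htw, hpsd⟩ => ?_⟩
  have hrec := frobRoots_map_reciprocal_of_twistedFE hq rfl htw (coeff_zero_ne_zero_of_twistedFE hq hh rfl htw)
  have hrecR : (frobRoots h).map (fun α => ((q : ℝ) : ℂ) / α) = frobRoots h := by
    simpa only [Complex.ofReal_natCast] using hrec
  exact (weilWindowForm_posSemidef_iff hqR hrecR (zero_not_mem_frobRoots_of_twistedFE hq hh rfl htw) hM).1 hpsd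

/-! ## The signed door theorem over a finite field -/

variable {K : Type u} [Field K] [Finite K]

/-- **Geometric up to a power ⇒ signed FE** (`q = #K`; Weil's RH only).  [PROVED from hW] -/
theorem twistedFE_of_geometric_pow (hW : ∀ A : AbelianVariety K, A.weilRiemannHypothesis) {h : ℤ[X]}
    (hh : h.Monic) {E : ℕ} (hE : 0 < E) {C : AbelianVariety K} (hC : C.IsFrobCharpoly (h ^ E)) :
    ∀ i j, i + j = h.natDegree → h.coeff 0 * h.coeff j = (Nat.card K : ℤ) ^ i * h.coeff i :=
  twistedFE_of_rh_deg Nat.card_pos hh (rh_of_geometric_pow hW hE hC)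

/-- **THE SIGNED DOOR THEOREM.**  Over a finite field `K`, `q = #K`, for EVERY monic `h ∈ ℤ[X]` of positive
degree: `(signed FE ∧ all windows PSD) ⟺ some power h^E (E ≥ 1) is the characteristic polynomial of the
Frobenius of an abelian variety over K`.  No parity or honesty hypothesis on `h`.  [PROVED from hW, hHT] -/
theorem signedDoor_abelianVariety (hW : ∀ A : AbelianVariety K, A.weilRiemannHypothesis)
    (hHT : AbelianVariety.hondaTateExistence K) {h : ℤ[X]} (hh : h.Monic) (hdeg : 0 < h.natDegree) :
    ((∀ i j, i + j = h.natDegree → h.coeff 0 * h.coeff j = (Nat.card K : ℤ) ^ i * h.coeff i) ∧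
        ∀ M, (weilWindowForm (Nat.card K : ℝ) h M).PosSemidef) ↔
      ∃ E : ℕ, 0 < E ∧ ∃ C : AbelianVariety K, C.IsFrobCharpoly (h ^ E) := by
  rw [← rh_iff_twistedFE_and_windows Nat.card_pos hh]
  exact rh_iff_exists_pow_geometric hW hHT hh hdeg

/-- **THE THREE DOORS AGREE, unconditionally in `h`:** for monic `h` of positive degree over `q = #K`,
RH(q,h), (signed FE ∧ windows PSD), and geometric-up-to-a-power are pairwise equivalent.
[PROVED from hW, hHT] -/
theorem signedDoor_tfae (hW : ∀ A : AbelianVariety K, A.weilRiemannHypothesis)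
    (hHT : AbelianVariety.hondaTateExistence K) {h : ℤ[X]} (hh : h.Monic) (hdeg : 0 < h.natDegree) :
    [∀ α ∈ frobRoots h, ‖α‖ = Real.sqrt (Nat.card K),
      (∀ i j, i + j = h.natDegree → h.coeff 0 * h.coeff j = (Nat.card K : ℤ) ^ i * h.coeff i) ∧
        ∀ M, (weilWindowForm (Nat.card K : ℝ) h M).PosSemidef,
      ∃ E : ℕ, 0 < E ∧ ∃ C : AbelianVariety K, C.IsFrobCharpoly (h ^ E)].TFAE := by
  have h12 := rh_iff_twistedFE_and_windows (h := h) (Nat.card_pos (α := K)) hh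
  have h13 := rh_iff_exists_pow_geometric hW hHT hh hdeg
  tfae_have 1 ↔ 2 := h12
  tfae_have 1 ↔ 3 := h13
  tfae_finish

/-! ## Instances: odd degree and the sign `-` -/

/-- Coefficients of `x - s`: `c₀ = -s`, `c₁ = 1`. [PROVED] -/
theorem coeff_X_sub_C_zero_one (s : ℤ) :
    (X - C s : ℤ[X]).coeff 0 = -s ∧ (X - C s : ℤ[X]).coeff 1 = 1 := by
  constructor
  · rw [coeff_sub, coeff_X_zero, coeff_C_zero, zero_sub]
  · rw [coeff_sub, coeff_X_one, coeff_C, if_neg one_ne_zero, sub_zero]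

/-- **Odd degree enters the door**: for any `s` the datum `(s², x - s)` satisfies the signed FE with
`c₀ = -s` (`c₀² = s² = q`). [PROVED] -/
theorem twistedFE_X_sub_C (s : ℤ) :
    ∀ i j, i + j = (X - C s : ℤ[X]).natDegree →
      (X - C s : ℤ[X]).coeff 0 * (X - C s : ℤ[X]).coeff j = ((s ^ 2).toNat : ℤ) ^ i * (X - C s).coeff i := by
  have hs2 : ((s ^ 2).toNat : ℤ) = s ^ 2 := Int.toNat_of_nonneg (sq_nonneg s)
  obtain ⟨h0, h1⟩ := coeff_X_sub_C_zero_one s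
  intro i j hij
  rw [natDegree_X_sub_C] at hij
  rw [hs2]
  rcases Nat.eq_zero_or_pos i with hi | hi
  · subst hi
    have hj : j = 1 := by omega
    subst hj
    rw [h1, pow_zero, one_mul, mul_one]
  · have hi1 : i = 1 := by omega
    have hj : j = 0 := by omega
    subst hi1; subst hj
    rw [h0, h1, pow_one, mul_one]; ring

/-- `x - s` is RH-true for `q = s²`: its root `s` has absolute value `√(s²) = |s|`. [PROVED] -/
theorem frobRoots_norm_eq_of_X_sub_C (s : ℤ) :
    ∀ α ∈ frobRoots (X - C s : ℤ[X]), ‖α‖ = Real.sqrt ((s ^ 2).toNat : ℕ) := by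
  intro α hα
  change α ∈ (Polynomial.map (Int.castRingHom ℂ) (X - C s)).roots at hα
  rw [Polynomial.map_sub, Polynomial.map_X, Polynomial.map_C, eq_intCast, roots_X_sub_C,
    Multiset.mem_singleton] at hα
  subst hα
  have hs2 : (((s ^ 2).toNat : ℕ) : ℝ) = ((s : ℝ)) ^ 2 := by
    have : ((s ^ 2).toNat : ℤ) = s ^ 2 := Int.toNat_of_nonneg (sq_nonneg s)
    exact_mod_cast this
  rw [hs2, Real.sqrt_sq_eq_abs, Complex.norm_intCast]

/-- **The real Weil number `s` is geometric up to a power**: over a finite field with `#K = s²`, some power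
of `x - s` is the characteristic polynomial of a Frobenius (e.g. `(x - 2)²` over `𝔽₄`, a supersingular
elliptic curve [DATA]).  [PROVED from hHT] -/
theorem exists_pow_geometric_X_sub_C (hHT : AbelianVariety.hondaTateExistence K) {s : ℤ}
    (hK : Nat.card K = (s ^ 2).toNat) :
    ∃ E : ℕ, 0 < E ∧ ∃ A : AbelianVariety K, A.IsFrobCharpoly ((X - C s) ^ E) := by
  refine exists_pow_geometric_of_rh hHT (monic_X_sub_C s) (by rw [natDegree_X_sub_C]; exact one_pos) ?_
  rw [hK]
  exact frobRoots_norm_eq_of_X_sub_C s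

/-- Coefficients of `x² - q`: `c₀ = -q`, `c₁ = 0`, `c₂ = 1`. [PROVED] -/
theorem coeff_X_sq_sub_C_natCast (q : ℕ) :
    (X ^ 2 - C (q : ℤ) : ℤ[X]).coeff 0 = -(q : ℤ) ∧ (X ^ 2 - C (q : ℤ) : ℤ[X]).coeff 1 = 0 ∧
      (X ^ 2 - C (q : ℤ) : ℤ[X]).coeff 2 = 1 := by
  refine ⟨?_, ?_, ?_⟩
  · rw [coeff_sub, coeff_X_pow, coeff_C_zero, if_neg (by decide), zero_sub]
  · rw [coeff_sub, coeff_X_pow, coeff_C, if_neg (by decide), if_neg one_ne_zero, sub_zero]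
  · rw [coeff_sub, coeff_X_pow, coeff_C, if_pos rfl, if_neg two_ne_zero, sub_zero]

/-- **The sign `-`**: `(q, x² - q)` satisfies the signed FE with `c₀ = -q`. [PROVED] -/
theorem twistedFE_X_sq_sub_C (q : ℕ) :
    ∀ i j, i + j = (X ^ 2 - C (q : ℤ) : ℤ[X]).natDegree →
      (X ^ 2 - C (q : ℤ) : ℤ[X]).coeff 0 * (X ^ 2 - C (q : ℤ) : ℤ[X]).coeff j =
        (q : ℤ) ^ i * (X ^ 2 - C (q : ℤ) : ℤ[X]).coeff i := by
  obtain ⟨h0, h1, h2⟩ := coeff_X_sq_sub_C_natCast q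
  intro i j hij
  rw [natDegree_X_pow_sub_C] at hij
  rcases Nat.lt_trichotomy i 1 with hi | hi | hi
  · have hi0 : i = 0 := by omega
    subst hi0
    have hj : j = 2 := by omega
    subst hj
    rw [h0, h2, pow_zero, one_mul, mul_one]
  · subst hi
    have hj : j = 1 := by omega
    subst hj
    rw [h1, mul_zero, mul_zero]
  · have hi2 : i = 2 := by omega
    subst hi2
    have hj : j = 0 := by omega
    subst hj
    rw [h0, h2, mul_one]; ring

end Summit.RiemannHypothesis.RiemannHypothesis.Theorems.MotivicDoor.FunctionField
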